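import Summits.AtomisticToContinuum.Crystallization.Theorems.ChargedEnergyGapStackingClassA
import HarnessLib

/-!
# ChargedEnergyGap · NODE 66 «StackingClass» (lens-3 g67) — part 2 of 2 (sequel of `…ChargedEnergyGapStackingClassA`)

Split for the 400-line cap by the landing lane (hand-2 g34); the module docstring of part 1 (`…ChargedEnergyGapStackingClassA`) describes the whole node.  Same namespace; all FQNs unchanged.
0 sorry; standard axioms.
-/

noncomputable section
open scoped Classical
open Literature.MathematicalPhysics.StatisticalMechanics Literature.Geometry.DiscreteGeometry
open Summit.AtomisticToContinuum.Crystallization.Theses.PricedLinkCensus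
open Summit.AtomisticToContinuum.Crystallization.Theorems.ChargedEnergyGapNegative

namespace Summit.AtomisticToContinuum.Crystallization.Theorems.ChargedEnergyGapChartDial

/-! ## §C3 The classification [CLS] and its analytic half [CLS-an] -/

section Classification

variable {P : PeriodicConfiguration 3}

/-- Bridge: a site-stress-free reference has vanishing site virial at EVERY point (not only on the motif) — lattice periodicity of the site
virial (`siteVirial_add_lattice`). -/
theorem IsSiteStressFree.siteVirial_eq_zero (hS : IsSiteStressFree P) {y : E3} (hy : y ∈ P.points) (a b : E3) : siteVirial P y a b = 0 := by
  obtain ⟨y₀, hy₀, g, hg, rfl⟩ := hy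
  rw [siteVirial_add_lattice hg]
  exact hS y₀ hy₀ a b

/-- ★ piece [CLS-an] · UNDECIDED · TRUE-leaning · INSTRUMENTABLE · CERT-able · **REGISTRY RIGIDITY OF SITE-STRESS-FREE BARLOW IMAGES**: if the
point set of a site-stress-free periodic reference is a rigid copy of `barlowStacking a h s` with `(a, h)` in the window, the Hägg word `s` has
a uniform second- and third-neighbour registry profile.  PLAN (memo g67 §2): [VIR] for a site `y` in layer `m` and the layer normal `n`,
`T_y(n, n) = τ₀(a, h) + Σ_{j ≥ 2} n_j(m)·δ_j^⊥(a, h)` where `n_j(m) = alignedPairs s j m` and `δ_j^⊥` is the aligned-minus-offset triangular-layer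
sum of `(V′(d)/d)·(jh)²` at height `jh` (the two offset classes `±w` give equal sums; layers `m ± 1` are never aligned); [DOM] on the window
`|δ₂^⊥| > 2Σ_{j≥3}|δ_j^⊥|` and `|δ₃^⊥| > 2Σ_{j≥4}|δ_j^⊥|` (g67 numerics: ratio `δ_j/δ_{j+1} ≈ 150–500`, margins `≥ 98 %`; interval certificate
outstanding).  Then `T_y = T_{y′} (= 0)` for sites of layers `m`, `m′` forces `n₂(m) = n₂(m′)` and then `n₃(m) = n₃(m′)`.  Why it might fail: only
by a zero of `δ₂^⊥` or `δ₃^⊥` inside the window (none on the grid; `δ₂^⊥ ≥ 1.5·10⁻⁴`, `δ₃^⊥ ≥ 1.2·10⁻⁷`). -/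
def BarlowRegistryRigidity : Prop :=
  ∀ (P : PeriodicConfiguration 3) (a h : ℝ) (s : ℤ → ℤ) (g : E3 → E3),
    (9 / 10 ≤ a ∧ a ≤ 11 / 10) → (0 < h ∧ 27 / 50 * a ^ 2 ≤ h ^ 2 ∧ h ^ 2 ≤ 121 / 150 * a ^ 2) → IsHaggSeq s → Isometry g →
      P.points = g '' barlowStacking a h s → IsSiteStressFree P → HasUniformRegistry s

/-- ★ piece [CLS] · UNDECIDED · TRUE-leaning (⟸ [CLS-an], below) · **THE STRESS-FREE CLASSIFICATION**: a site-stress-free periodic reference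
whose point set is a Barlow image (window included) is an fcc-class image or an hcp-class image.  (The tree's `…RotationTest` §M1 records the
content informally: "fcc and hcp are; no other Barlow stacking is (dhcp carries `±(−3.35·10⁻⁴, −3.35·10⁻⁴, +9.6·10⁻⁴)` per layer)".) -/
def BarlowStressFreeClassification : Prop :=
  ∀ P : PeriodicConfiguration 3, IsBarlowImage P.points → IsSiteStressFree P → IsFccImage P.points ∨ IsHcpImage P.points

/-- ★ GLUE (PROVED): [CLS-an] ⟹ [CLS], through the combinatorial classification [CLS-comb]. -/
theorem barlowStressFreeClassification_of_rigidity (h : BarlowRegistryRigidity) : BarlowStressFreeClassification := by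
  intro P hB hS
  obtain ⟨a, hh, s, g, ha, hh', hs, hg, hP⟩ := hB
  rcases isFccHagg_or_isHcpHagg_of_uniformRegistry hs (h P a hh s g ha hh' hs hg hP hS) with hf | hc
  · exact Or.inl ⟨a, hh, s, g, ha, hh', hs, hf, hg, hP⟩
  · exact Or.inr ⟨a, hh, s, g, ha, hh', hs, hc, hg, hP⟩

end Classification

/-! ## §C4 ★ The (R4) pieces (H𝄪ᶠ), (H𝄪ʰ), the certified translation, and the re-typed reduction (N𝄪ᶠʰ) -/

section PairFH

variable (s lam ℓ μ₀ τ lamQ ϱ b₀ r_S C_T ϱχ Cχ : ℝ)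

/-- ★ piece LOCAL-TRANSFERᶠᶜᶜ(`C_T`, `Cχ`, `ϱχ`) · **(H𝄪ᶠ) = (H𝄪ᴮ) RESTRICTED TO fcc-CLASS REFERENCES**: the localised seam transfer bound VERBATIM
(twelve dials, conclusion) with the reference binder `IsFccImage P.points` in place of `IsBarlowImage P.points` · WEAKER than (H𝄪ᴮ)
(`LocalSeamTransferBoundB.fcc`) · UNDECIDED → TRUE-leaning at the record · INSTRUMENTABLE · ATTACKABLE-M.  The reference is a rigid copy of an
explicit (rhombohedrally strained) fcc lattice; at a cubic point its sites are inversion centres (`O_h`), so the periodic-direction load of the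
`(p, S)` second variation starts at `O(∇³ω)`.  Why it might fail: as (H𝄪ᴮ) — an excised-collar geometry beating `(C_T, Cχ) = (1/(3·10⁶), 10⁻⁵)`. -/
def LocalSeamTransferBoundFcc : Prop :=
  ∃ C_H : ℝ, 0 ≤ C_H ∧ ∀ (P : PeriodicConfiguration 3) (C X : Set E3) (β₀ : E3 → E3 → E3) (k : ℕ) (S : Fin k → CutPiece)
    (m : ℕ) (D : Fin m → Set E3) (σ : Fin m → Bool),
    IsSeparatedRef s P → IsLabelledRef lam ℓ P → IsFccImage P.points → IsForceFree P → IsSiteStressFree P → HarmStableModRot μ₀ P →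
    IsInvariantSet P C → IsInvariantSet P X → IsGlobalCocycle P β₀ → IsSeamSystem b₀ r_S P S →
    SmallStrain τ P X (volterraField P S β₀) → (∀ i, IsInvariantSet P (D i)) →
      -(C_T * shellMassL ϱχ D σ P X ϱ C) - Cχ * transMassL ϱχ D σ P X ϱ C - C_H * (pricedNearCountL ϱχ D σ P X ϱ C : ℝ) ≤
        modelFarL ϱχ D σ (volterraField P S β₀) P X lamQ ϱ C

/-- ★ piece LOCAL-TRANSFERʰᶜᵖ(`C_T`, `Cχ`, `ϱχ`) · **(H𝄪ʰ) = (H𝄪ᴮ) RESTRICTED TO hcp-CLASS REFERENCES** (binder `IsHcpImage P.points`) · WEAKER than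
(H𝄪ᴮ) (`LocalSeamTransferBoundB.hcp`; STRICTLY: it drops the inhabited fcc class, `hypothesisBlockFcc_record_inhabited`) · UNDECIDED → TRUE-leaning
· INSTRUMENTABLE · ATTACKABLE-M.  The reference is a rigid copy of `hcpStacking a h`, `(a, h)` in the window; its sites have symmetry `D_3h`
(no inversion: an `O(∇²ω)` internal load survives in prism-plane geometries; census χCOST-56 hcp(1-100) `−1.01·10⁻⁶` per transition site, PASS).
Why it might fail: as (H𝄪ᴮ), plus the rank-3 (`y(3x²−y²)`-type) internal-relaxation channel absent in fcc. -/
def LocalSeamTransferBoundHcp : Prop :=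
  ∃ C_H : ℝ, 0 ≤ C_H ∧ ∀ (P : PeriodicConfiguration 3) (C X : Set E3) (β₀ : E3 → E3 → E3) (k : ℕ) (S : Fin k → CutPiece)
    (m : ℕ) (D : Fin m → Set E3) (σ : Fin m → Bool),
    IsSeparatedRef s P → IsLabelledRef lam ℓ P → IsHcpImage P.points → IsForceFree P → IsSiteStressFree P → HarmStableModRot μ₀ P →
    IsInvariantSet P C → IsInvariantSet P X → IsGlobalCocycle P β₀ → IsSeamSystem b₀ r_S P S →
    SmallStrain τ P X (volterraField P S β₀) → (∀ i, IsInvariantSet P (D i)) →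
      -(C_T * shellMassL ϱχ D σ P X ϱ C) - Cχ * transMassL ϱχ D σ P X ϱ C - C_H * (pricedNearCountL ϱχ D σ P X ϱ C : ℝ) ≤
        modelFarL ϱχ D σ (volterraField P S β₀) P X lamQ ϱ C

variable {s lam ℓ μ₀ τ lamQ ϱ b₀ r_S C_T ϱχ Cχ}

/-- NECESSITY: (H𝄪ᴮ) ⟹ (H𝄪ᶠ) (fewer references). -/
theorem LocalSeamTransferBoundB.fcc (h : LocalSeamTransferBoundB s lam ℓ μ₀ τ lamQ ϱ b₀ r_S C_T ϱχ Cχ) :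
    LocalSeamTransferBoundFcc s lam ℓ μ₀ τ lamQ ϱ b₀ r_S C_T ϱχ Cχ := by
  obtain ⟨C_H, hH, h⟩ := h
  exact ⟨C_H, hH, fun P C X β₀ k S m D σ h1 h2 hb h3 h4 h5 h6 h7 h8 h9 h10 h11 =>
    h P C X β₀ k S m D σ h1 h2 hb.isBarlowImage h3 h4 h5 h6 h7 h8 h9 h10 h11⟩

/-- NECESSITY: (H𝄪ᴮ) ⟹ (H𝄪ʰ). -/
theorem LocalSeamTransferBoundB.hcp (h : LocalSeamTransferBoundB s lam ℓ μ₀ τ lamQ ϱ b₀ r_S C_T ϱχ Cχ) :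
    LocalSeamTransferBoundHcp s lam ℓ μ₀ τ lamQ ϱ b₀ r_S C_T ϱχ Cχ := by
  obtain ⟨C_H, hH, h⟩ := h
  exact ⟨C_H, hH, fun P C X β₀ k S m D σ h1 h2 hb h3 h4 h5 h6 h7 h8 h9 h10 h11 =>
    h P C X β₀ k S m D σ h1 h2 hb.isBarlowImage h3 h4 h5 h6 h7 h8 h9 h10 h11⟩

/-- ★★ **THE CERTIFIED TRANSLATION** (sufficiency, PROVED): [CLS] ∧ (H𝄪ᶠ) ∧ (H𝄪ʰ) ⟹ (H𝄪ᴮ), with `C_H := max C_Hᶠ C_Hʰ` (the priced-near count is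
non-negative). -/
theorem localSeamTransferBoundB_of_fcc_of_hcp (hC : BarlowStressFreeClassification)
    (hf : LocalSeamTransferBoundFcc s lam ℓ μ₀ τ lamQ ϱ b₀ r_S C_T ϱχ Cχ) (hh : LocalSeamTransferBoundHcp s lam ℓ μ₀ τ lamQ ϱ b₀ r_S C_T ϱχ Cχ) :
    LocalSeamTransferBoundB s lam ℓ μ₀ τ lamQ ϱ b₀ r_S C_T ϱχ Cχ := by
  obtain ⟨C₁, hC₁, h₁⟩ := hf
  obtain ⟨C₂, hC₂, h₂⟩ := hh
  refine ⟨max C₁ C₂, hC₁.trans (le_max_left _ _), fun P C X β₀ k S m D σ h1 h2 hb h3 h4 h5 h6 h7 h8 h9 h10 h11 => ?_⟩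
  have hnn : (0 : ℝ) ≤ (pricedNearCountL ϱχ D σ P X ϱ C : ℝ) := Nat.cast_nonneg _
  rcases hC P hb h4 with hF | hH
  · have := h₁ P C X β₀ k S m D σ h1 h2 hF h3 h4 h5 h6 h7 h8 h9 h10 h11
    have hm : C₁ * (pricedNearCountL ϱχ D σ P X ϱ C : ℝ) ≤ max C₁ C₂ * (pricedNearCountL ϱχ D σ P X ϱ C : ℝ) :=
      mul_le_mul_of_nonneg_right (le_max_left _ _) hnn
    linarith
  · have := h₂ P C X β₀ k S m D σ h1 h2 hH h3 h4 h5 h6 h7 h8 h9 h10 h11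
    have hm : C₂ * (pricedNearCountL ϱχ D σ P X ϱ C : ℝ) ≤ max C₁ C₂ * (pricedNearCountL ϱχ D σ P X ϱ C : ℝ) :=
      mul_le_mul_of_nonneg_right (le_max_right _ _) hnn
    linarith

/-- ★★ THE ONE EQUIVALENCE OF THE NODE: modulo the classification, (H𝄪ᴮ) ⟺ (H𝄪ᶠ) ∧ (H𝄪ʰ). -/
theorem localSeamTransferBoundB_iff_fcc_and_hcp (hC : BarlowStressFreeClassification) :
    LocalSeamTransferBoundB s lam ℓ μ₀ τ lamQ ϱ b₀ r_S C_T ϱχ Cχ ↔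
      LocalSeamTransferBoundFcc s lam ℓ μ₀ τ lamQ ϱ b₀ r_S C_T ϱχ Cχ ∧ LocalSeamTransferBoundHcp s lam ℓ μ₀ τ lamQ ϱ b₀ r_S C_T ϱχ Cχ :=
  ⟨fun h => ⟨h.fcc, h.hcp⟩, fun h => localSeamTransferBoundB_of_fcc_of_hcp hC h.1 h.2⟩

/-- (H𝄪ˢ) ⟹ (H𝄪ᶠ) ∧ (H𝄪ʰ) (through (H𝄪ᴮ)). -/
theorem localSeamTransferBoundFcc_and_hcp_of_S (h : LocalSeamTransferBoundS s lam ℓ μ₀ τ lamQ ϱ b₀ r_S C_T ϱχ Cχ) :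
    LocalSeamTransferBoundFcc s lam ℓ μ₀ τ lamQ ϱ b₀ r_S C_T ϱχ Cχ ∧ LocalSeamTransferBoundHcp s lam ℓ μ₀ τ lamQ ϱ b₀ r_S C_T ϱχ Cχ :=
  ⟨(localSeamTransferBoundB_of_S h).fcc, (localSeamTransferBoundB_of_S h).hcp⟩

/-- (H𝄪ᶠ) is monotone in the transfer constant `C_T` … -/
theorem LocalSeamTransferBoundFcc.mono_CT {C_T' : ℝ} (hC : C_T ≤ C_T') (h : LocalSeamTransferBoundFcc s lam ℓ μ₀ τ lamQ ϱ b₀ r_S C_T ϱχ Cχ) :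
    LocalSeamTransferBoundFcc s lam ℓ μ₀ τ lamQ ϱ b₀ r_S C_T' ϱχ Cχ := by
  obtain ⟨C_H, hH, h⟩ := h
  refine ⟨C_H, hH, fun P C X β₀ k S m D σ h1 h2 hb h3 h4 h5 h6 h7 h8 h9 h10 h11 =>
    le_trans ?_ (h P C X β₀ k S m D σ h1 h2 hb h3 h4 h5 h6 h7 h8 h9 h10 h11)⟩
  have := shellMassL_nonneg (ϱχ := ϱχ) (D := D) (σ := σ) P X ϱ C
  nlinarith

/-- … and so is (H𝄪ʰ). -/
theorem LocalSeamTransferBoundHcp.mono_CT {C_T' : ℝ} (hC : C_T ≤ C_T') (h : LocalSeamTransferBoundHcp s lam ℓ μ₀ τ lamQ ϱ b₀ r_S C_T ϱχ Cχ) :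
    LocalSeamTransferBoundHcp s lam ℓ μ₀ τ lamQ ϱ b₀ r_S C_T' ϱχ Cχ := by
  obtain ⟨C_H, hH, h⟩ := h
  refine ⟨C_H, hH, fun P C X β₀ k S m D σ h1 h2 hb h3 h4 h5 h6 h7 h8 h9 h10 h11 =>
    le_trans ?_ (h P C X β₀ k S m D σ h1 h2 hb h3 h4 h5 h6 h7 h8 h9 h10 h11)⟩
  have := shellMassL_nonneg (ϱχ := ϱχ) (D := D) (σ := σ) P X ϱ C
  nlinarith

variable (s lam ℓ μ₀ τ lamQ ϱ b₀ r_S C_T ϱχ Cχ)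
variable {θ ε R r η L δ L' : ℝ} (W : CoreWeights θ ε R r η L δ L' ϱ) (c₁ ρ₀ B₀ : ℝ)

/-- ★ piece LOCAL-REDUCTIONᶠʰ_W · **(N𝄪ᶠʰ) = THE (R4) RE-TYPED REDUCTION**: the two class-restricted transfer bounds imply the budget far leaf ·
STRONGER than (N𝄪ᴮ) (`localSeamReductionB_of_FH`), WEAKER than the leaf (`localSeamReductionFH_of_budget`), EQUIVALENT to (N𝄪ᴮ) under [CLS]
(`localSeamReductionFH_of_B`) · UNDECIDED (TRUE-leaning with the leaf for the max cover) · ATTACKABLE-L.  Proof obligations: exactly those of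
(N𝄪ᴮ) — every reference handed to the transfer pieces is an fcc(`a₀`) supercell (`Fcc.isFccImage_fccRef_a0`) or an hcp(`a*, h*`) supercell
(`isHcpImage_hcpStacking`, window owed as «STAB-k») — so the classification [CLS] is NOT on the cone's path. -/
def LocalSeamReductionFH : Prop :=
  LocalSeamTransferBoundFcc s lam ℓ μ₀ τ lamQ ϱ b₀ r_S C_T ϱχ Cχ → LocalSeamTransferBoundHcp s lam ℓ μ₀ τ lamQ ϱ b₀ r_S C_T ϱχ Cχ →
    FarLabelledFloorCoredBudgetW W c₁ s ρ₀ lam ℓ B₀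

variable {s lam ℓ μ₀ τ lamQ ϱ b₀ r_S C_T ϱχ Cχ W c₁ ρ₀ B₀}

/-- ★ THE SPLIT (glue, PROVED; modus ponens): (H𝄪ᶠ) ∧ (H𝄪ʰ) ∧ (N𝄪ᶠʰ) ⟹ CB-FAR_W|cored,`B₀`. -/
theorem farLabelledFloorCoredBudgetW_of_localFH (hf : LocalSeamTransferBoundFcc s lam ℓ μ₀ τ lamQ ϱ b₀ r_S C_T ϱχ Cχ)
    (hh : LocalSeamTransferBoundHcp s lam ℓ μ₀ τ lamQ ϱ b₀ r_S C_T ϱχ Cχ)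
    (hN : LocalSeamReductionFH s lam ℓ μ₀ τ lamQ ϱ b₀ r_S C_T ϱχ Cχ W c₁ ρ₀ B₀) : FarLabelledFloorCoredBudgetW W c₁ s ρ₀ lam ℓ B₀ :=
  hN hf hh

/-- WEAKER than the leaf: CB-FAR_W|cored,`B₀` ⟹ (N𝄪ᶠʰ). -/
theorem localSeamReductionFH_of_budget (h : FarLabelledFloorCoredBudgetW W c₁ s ρ₀ lam ℓ B₀) :
    LocalSeamReductionFH s lam ℓ μ₀ τ lamQ ϱ b₀ r_S C_T ϱχ Cχ W c₁ ρ₀ B₀ :=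
  fun _ _ => h

/-- ★ STRONGER: (N𝄪ᶠʰ) ⟹ (N𝄪ᴮ) (unconditionally, by necessity). -/
theorem localSeamReductionB_of_FH (h : LocalSeamReductionFH s lam ℓ μ₀ τ lamQ ϱ b₀ r_S C_T ϱχ Cχ W c₁ ρ₀ B₀) :
    LocalSeamReductionB s lam ℓ μ₀ τ lamQ ϱ b₀ r_S C_T ϱχ Cχ W c₁ ρ₀ B₀ :=
  fun hB => h hB.fcc hB.hcp

/-- … hence (N𝄪ᶠʰ) ⟹ (N𝄪ˢ). -/
theorem localSeamReductionS_of_FH (h : LocalSeamReductionFH s lam ℓ μ₀ τ lamQ ϱ b₀ r_S C_T ϱχ Cχ W c₁ ρ₀ B₀) :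
    LocalSeamReductionS s lam ℓ μ₀ τ lamQ ϱ b₀ r_S C_T ϱχ Cχ W c₁ ρ₀ B₀ :=
  localSeamReductionS_of_B (localSeamReductionB_of_FH h)

/-- Under the classification the two reductions coincide: [CLS] ∧ (N𝄪ᴮ) ⟹ (N𝄪ᶠʰ). -/
theorem localSeamReductionFH_of_B (hC : BarlowStressFreeClassification)
    (h : LocalSeamReductionB s lam ℓ μ₀ τ lamQ ϱ b₀ r_S C_T ϱχ Cχ W c₁ ρ₀ B₀) :
    LocalSeamReductionFH s lam ℓ μ₀ τ lamQ ϱ b₀ r_S C_T ϱχ Cχ W c₁ ρ₀ B₀ :=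
  fun hf hh => h (localSeamTransferBoundB_of_fcc_of_hcp hC hf hh)

/-- (N𝄪ᶠʰ) is antitone in `C_T`. -/
theorem LocalSeamReductionFH.anti_CT {C_T' : ℝ} (hC : C_T ≤ C_T')
    (h : LocalSeamReductionFH s lam ℓ μ₀ τ lamQ ϱ b₀ r_S C_T' ϱχ Cχ W c₁ ρ₀ B₀) :
    LocalSeamReductionFH s lam ℓ μ₀ τ lamQ ϱ b₀ r_S C_T ϱχ Cχ W c₁ ρ₀ B₀ :=
  fun hf hh => h (hf.mono_CT hC) (hh.mono_CT hC)

end PairFH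

/-! ## §C5 ★★ Record cones over the (R4) pieces -/

section RecordFH

/-- ★★ **THE ELEVEN-LEAF RECORD CONE FOR EVERY WEIGHT SYSTEM, (R4)-RE-TYPED**: `ChargeRecount · IP_G · FCP_G · CCP_G · REG-BALL_W · LABEL_W ·
SHELL-BUDGET_W(10⁵) · LOCAL-TRANSFERᶠᶜᶜ · LOCAL-TRANSFERʰᶜᵖ(1/(3·10⁶), 10⁻⁵, 80) · LOCAL-REDUCTIONᶠʰ_W · P_G ⟹ ChargedEnergyGap`, any `ϱ`, any `W`. -/
theorem chargedEnergyGap_of_localLedgerFH {ϱ : ℝ} (W : CoreWeights (3 / 20) (1 / 10) (6 / 5) 10 (1 / 100) 40 (1 / 10) 40 ϱ)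
    (hF : ChargeRecount)
    (hIP : ImprovablePricingG (3 / 20) (1 / 10) (6 / 5) 10 (1 / 100) (3 / 5))
    (hFCP : FrustratedCorePricingG (3 / 20) (1 / 10) (6 / 5) 10 (1 / 100) 40 (3 / 5))
    (hCCP : CoherentCorePricingG (3 / 20) (1 / 10) (6 / 5) 10 (1 / 100) 40 (1 / 10) 40 (3 / 5))
    (hB : CoreBallRegularPricingW W (1 / 20) (3 / 5) 10 fun _ _ => True)
    (hLab : CleanLabellingW W (3 / 5) 10 (1 / 3) 3)
    (hSB : ShellBudgetW W (3 / 5) 100000)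
    (hSf : LocalSeamTransferBoundFcc (3 / 5) (1 / 3) 3 (1 / 100) (3 / 100) (1 / 2) ϱ (2 / 5) 3 (1 / 3000000) 80 (1 / 100000))
    (hSh : LocalSeamTransferBoundHcp (3 / 5) (1 / 3) 3 (1 / 100) (3 / 100) (1 / 2) ϱ (2 / 5) 3 (1 / 3000000) 80 (1 / 100000))
    (hN : LocalSeamReductionFH (3 / 5) (1 / 3) 3 (1 / 100) (3 / 100) (1 / 2) ϱ (2 / 5) 3 (1 / 3000000) 80 (1 / 100000) W (1 / 20) 10
      100000)
    (hP : ChartedChargePricingG (3 / 20) (1 / 10) (3 / 5)) : ChargedEnergyGap :=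
  chargedEnergyGap_of_budgetLedger W hF hIP hFCP hCCP hB hLab hSB (farLabelledFloorCoredBudgetW_of_localFH hSf hSh hN) hP

/-- ★★ **THE MAX-COVER ELEVEN-LEAF RECORD CONE, (R4)-RE-TYPED** at `ϱ = 160` — THE RECORD-DESIGNATE OF GENERATION 67: `ChargeRecount · IP_G · FCP_G ·
CCP_G · REG-BALL_M · LABEL_M · SHELL-BUDGET_M(10⁵) · LOCAL-TRANSFERᶠᶜᶜ · LOCAL-TRANSFERʰᶜᵖ(1/(3·10⁶), 10⁻⁵, 80) · LOCAL-REDUCTIONᶠʰ_M · P_G ⟹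
ChargedEnergyGap`.  No classification hypothesis. -/
theorem chargedEnergyGap_of_maxCoverLocalLedgerFH_record (hF : ChargeRecount)
    (hIP : ImprovablePricingG (3 / 20) (1 / 10) (6 / 5) 10 (1 / 100) (3 / 5))
    (hFCP : FrustratedCorePricingG (3 / 20) (1 / 10) (6 / 5) 10 (1 / 100) 40 (3 / 5))
    (hCCP : CoherentCorePricingG (3 / 20) (1 / 10) (6 / 5) 10 (1 / 100) 40 (1 / 10) 40 (3 / 5))
    (hB : CoreBallRegularPricingW (maxCoverWeights (3 / 20) (1 / 10) (6 / 5) 10 (1 / 100) 40 (1 / 10) 40 160) (1 / 20) (3 / 5) 10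
      fun _ _ => True)
    (hLab : CleanLabellingW (maxCoverWeights (3 / 20) (1 / 10) (6 / 5) 10 (1 / 100) 40 (1 / 10) 40 160) (3 / 5) 10 (1 / 3) 3)
    (hSB : ShellBudgetW (maxCoverWeights (3 / 20) (1 / 10) (6 / 5) 10 (1 / 100) 40 (1 / 10) 40 160) (3 / 5) 100000)
    (hSf : LocalSeamTransferBoundFcc (3 / 5) (1 / 3) 3 (1 / 100) (3 / 100) (1 / 2) 160 (2 / 5) 3 (1 / 3000000) 80 (1 / 100000))
    (hSh : LocalSeamTransferBoundHcp (3 / 5) (1 / 3) 3 (1 / 100) (3 / 100) (1 / 2) 160 (2 / 5) 3 (1 / 3000000) 80 (1 / 100000))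
    (hN : LocalSeamReductionFH (3 / 5) (1 / 3) 3 (1 / 100) (3 / 100) (1 / 2) 160 (2 / 5) 3 (1 / 3000000) 80 (1 / 100000)
      (maxCoverWeights (3 / 20) (1 / 10) (6 / 5) 10 (1 / 100) 40 (1 / 10) 40 160) (1 / 20) 10 100000)
    (hP : ChartedChargePricingG (3 / 20) (1 / 10) (3 / 5)) : ChargedEnergyGap :=
  chargedEnergyGap_of_maxCoverBudgetLedger_record hF hIP hFCP hCCP hB hLab hSB (farLabelledFloorCoredBudgetW_of_localFH hSf hSh hN) hP

/-- ★ THE CLASSIFICATION VARIANT of the record cone: `… · [CLS] · LOCAL-TRANSFERᶠᶜᶜ · LOCAL-TRANSFERʰᶜᵖ · LOCAL-REDUCTIONᴮ_M · P_G ⟹ ChargedEnergyGap`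
(the (R3) reduction (N𝄪ᴮ) kept; (H𝄪ᴮ) supplied by the certified translation). -/
theorem chargedEnergyGap_of_maxCoverLocalLedgerCls_record (hF : ChargeRecount)
    (hIP : ImprovablePricingG (3 / 20) (1 / 10) (6 / 5) 10 (1 / 100) (3 / 5))
    (hFCP : FrustratedCorePricingG (3 / 20) (1 / 10) (6 / 5) 10 (1 / 100) 40 (3 / 5))
    (hCCP : CoherentCorePricingG (3 / 20) (1 / 10) (6 / 5) 10 (1 / 100) 40 (1 / 10) 40 (3 / 5))
    (hB : CoreBallRegularPricingW (maxCoverWeights (3 / 20) (1 / 10) (6 / 5) 10 (1 / 100) 40 (1 / 10) 40 160) (1 / 20) (3 / 5) 10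
      fun _ _ => True)
    (hLab : CleanLabellingW (maxCoverWeights (3 / 20) (1 / 10) (6 / 5) 10 (1 / 100) 40 (1 / 10) 40 160) (3 / 5) 10 (1 / 3) 3)
    (hSB : ShellBudgetW (maxCoverWeights (3 / 20) (1 / 10) (6 / 5) 10 (1 / 100) 40 (1 / 10) 40 160) (3 / 5) 100000)
    (hC : BarlowStressFreeClassification)
    (hSf : LocalSeamTransferBoundFcc (3 / 5) (1 / 3) 3 (1 / 100) (3 / 100) (1 / 2) 160 (2 / 5) 3 (1 / 3000000) 80 (1 / 100000))
    (hSh : LocalSeamTransferBoundHcp (3 / 5) (1 / 3) 3 (1 / 100) (3 / 100) (1 / 2) 160 (2 / 5) 3 (1 / 3000000) 80 (1 / 100000))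
    (hN : LocalSeamReductionB (3 / 5) (1 / 3) 3 (1 / 100) (3 / 100) (1 / 2) 160 (2 / 5) 3 (1 / 3000000) 80 (1 / 100000)
      (maxCoverWeights (3 / 20) (1 / 10) (6 / 5) 10 (1 / 100) 40 (1 / 10) 40 160) (1 / 20) 10 100000)
    (hP : ChartedChargePricingG (3 / 20) (1 / 10) (3 / 5)) : ChargedEnergyGap :=
  chargedEnergyGap_of_maxCoverLocalLedgerB_record hF hIP hFCP hCCP hB hLab hSB (localSeamTransferBoundB_of_fcc_of_hcp hC hSf hSh) hN hP

/-- Consistency: a proof of the generation-64 pair (H𝄪ᴮ)/(N𝄪ᶠʰ) — or of (H𝄪ᴮ) alone with the leaf — feeds the g67 cone ((H𝄪ᴮ) into both slots). -/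
theorem chargedEnergyGap_of_maxCoverLocalLedgerFH_of_B (hF : ChargeRecount)
    (hIP : ImprovablePricingG (3 / 20) (1 / 10) (6 / 5) 10 (1 / 100) (3 / 5))
    (hFCP : FrustratedCorePricingG (3 / 20) (1 / 10) (6 / 5) 10 (1 / 100) 40 (3 / 5))
    (hCCP : CoherentCorePricingG (3 / 20) (1 / 10) (6 / 5) 10 (1 / 100) 40 (1 / 10) 40 (3 / 5))
    (hB : CoreBallRegularPricingW (maxCoverWeights (3 / 20) (1 / 10) (6 / 5) 10 (1 / 100) 40 (1 / 10) 40 160) (1 / 20) (3 / 5) 10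
      fun _ _ => True)
    (hLab : CleanLabellingW (maxCoverWeights (3 / 20) (1 / 10) (6 / 5) 10 (1 / 100) 40 (1 / 10) 40 160) (3 / 5) 10 (1 / 3) 3)
    (hSB : ShellBudgetW (maxCoverWeights (3 / 20) (1 / 10) (6 / 5) 10 (1 / 100) 40 (1 / 10) 40 160) (3 / 5) 100000)
    (hS : LocalSeamTransferBoundB (3 / 5) (1 / 3) 3 (1 / 100) (3 / 100) (1 / 2) 160 (2 / 5) 3 (1 / 3000000) 80 (1 / 100000))
    (hN : LocalSeamReductionFH (3 / 5) (1 / 3) 3 (1 / 100) (3 / 100) (1 / 2) 160 (2 / 5) 3 (1 / 3000000) 80 (1 / 100000)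
      (maxCoverWeights (3 / 20) (1 / 10) (6 / 5) 10 (1 / 100) 40 (1 / 10) 40 160) (1 / 20) 10 100000)
    (hP : ChartedChargePricingG (3 / 20) (1 / 10) (3 / 5)) : ChargedEnergyGap :=
  chargedEnergyGap_of_maxCoverLocalLedgerFH_record hF hIP hFCP hCCP hB hLab hSB hS.fcc hS.hcp hN hP

end RecordFH

/-! ## §C6 The layer-sum certificate beneath [CLS-an] (typed targets for the census) -/

section LayerSums

/-- **THE NORMAL–NORMAL LAYER SUM** of a triangular layer at height `j·h` in registry class `t` (`t = 0`: in registry with the base site;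
`t = ±1`: shifted by `±w`, the two classes giving the same sum by `p ↦ −p`): `Σ_{(i,i′) ∈ ℤ²} (V′(d)/d)·(jh)²`,
`d = ‖i u + i′ v + t w + j h e₃‖` — the contribution of that layer to the site virial `T_y(e₃, e₃)` of a site `y` of the base layer
(`V′ = ljD1`, the weight of `siteVirial`). -/
def layerSumNN (a h : ℝ) (j : ℕ) (t : ℤ) : ℝ :=
  ∑' p : ℤ × ℤ,
    ljD1 ‖(p.1 : ℝ) • triangularVec₁ a + (p.2 : ℝ) • triangularVec₂ a + (t : ℝ) • barlowOffset a + (j : ℝ) • layerNormal h‖ /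
        ‖(p.1 : ℝ) • triangularVec₁ a + (p.2 : ℝ) • triangularVec₂ a + (t : ℝ) • barlowOffset a + (j : ℝ) • layerNormal h‖ *
      ((j : ℝ) * h) ^ 2

/-- **THE REGISTRY CONTRAST** `δ_j^⊥(a, h)` := in-registry minus shifted layer sum at height `j·h`.  (g67 numerics, Poisson side:
`δ₂^⊥ ∈ [1.5·10⁻⁴, 2.9·10⁻³]`, `δ₃^⊥ ∈ [1.2·10⁻⁷, 1.7·10⁻⁵]`, `δ₄^⊥ ≤ 6·10⁻⁸` on the window; at the hcp point `2δ₂ = (∥ −6.7·10⁻⁴, ⊥ +1.92·10⁻³)`,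
the dhcp layer residual of `…RotationTest` §M1.) -/
def layerDeltaNN (a h : ℝ) (j : ℕ) : ℝ :=
  layerSumNN a h j 0 - layerSumNN a h j 1

/-- ★ piece [DOM] · UNDECIDED · TRUE-leaning (floats, margins `≥ 98 %`) · CERT-able (interval arithmetic on `2 + 2·11²` Poisson/direct sums) ·
**LAYER DOMINANCE ON THE WINDOW**: the second-neighbour registry contrast beats twice the sum of all farther ones, and the third-neighbour contrast
beats twice the sum of all beyond it:  `2·Σ_{j≥3}|δ_j^⊥| < |δ₂^⊥|` and `2·Σ_{j≥4}|δ_j^⊥| < |δ₃^⊥|` for all `(a, h)` in the window.  Why it might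
fail: only through a zero of `δ₂^⊥` or `δ₃^⊥` in the window (none: both are positive with ratio `δ_j/δ_{j+1} ≈ 10²`). -/
def LayerDominance : Prop :=
  ∀ a h : ℝ, (9 / 10 ≤ a ∧ a ≤ 11 / 10) → (0 < h ∧ 27 / 50 * a ^ 2 ≤ h ^ 2 ∧ h ^ 2 ≤ 121 / 150 * a ^ 2) →
    2 * ∑' j : ℕ, |layerDeltaNN a h (j + 3)| < |layerDeltaNN a h 2| ∧ 2 * ∑' j : ℕ, |layerDeltaNN a h (j + 4)| < |layerDeltaNN a h 3|

/-- ★ piece [VIR-red] · UNDECIDED · TRUE · ATTACKABLE-M · **THE LAYER-SUM IDENTITY (as a reduction)**: [DOM] ⟹ [CLS-an].  Content: for a site `y`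
in layer `m` of `g '' barlowStacking a h s` and the image normal `n = g_lin e₃`, regroup `siteVirial P y n n` (absolutely summable,
`summable_virial`) by layers: the layer at signed distance `j′` contributes `layerSumNN a h |j′| t` with `t = 0` iff `HaggAligned` holds between
the two layers (`barlowLayer_add_eq_image_of_haggAligned`, `three_smul_barlowOffset`), else the shifted value; hence
`T_y(n,n) − T_{y′}(n,n) = Σ_{j≥2} (n_j(m) − n_j(m′))·δ_j^⊥` for sites of layers `m`, `m′` (`n_j = alignedPairs s j`, `|n_j − n_j′| ≤ 2`, layers
`m ± 1` never aligned), and site-stress-freeness at all points (`IsSiteStressFree.siteVirial_eq_zero`) with [DOM] forces `n₂(m) = n₂(m′)`, then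
`n₃(m) = n₃(m′)`. -/
def RegistryRigidityOfDominance : Prop :=
  LayerDominance → BarlowRegistryRigidity

/-- GLUE (PROVED): [DOM] ∧ [VIR-red] ⟹ [CLS-an] ⟹ [CLS]. -/
theorem barlowStressFreeClassification_of_dominance (hD : LayerDominance) (hR : RegistryRigidityOfDominance) :
    BarlowStressFreeClassification :=
  barlowStressFreeClassification_of_rigidity (hR hD)

/-- The shifted classes `t = 1` and `t = −1` give the same layer sum (re-index `p ↦ −p`; the height term is orthogonal to the layer). -/
theorem layerSumNN_neg_one (a h : ℝ) (j : ℕ) : layerSumNN a h j (-1) = layerSumNN a h j 1 := by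
  unfold layerSumNN
  rw [← (Equiv.neg (ℤ × ℤ)).tsum_eq]
  refine tsum_congr fun p => ?_
  have key : ‖((-p).1 : ℝ) • triangularVec₁ a + ((-p).2 : ℝ) • triangularVec₂ a + ((-1 : ℤ) : ℝ) • barlowOffset a + (j : ℝ) • layerNormal h‖ =
      ‖(p.1 : ℝ) • triangularVec₁ a + (p.2 : ℝ) • triangularVec₂ a + ((1 : ℤ) : ℝ) • barlowOffset a + (j : ℝ) • layerNormal h‖ := by
    rw [EuclideanSpace.norm_eq, EuclideanSpace.norm_eq]
    congr 1
    simp only [Fin.sum_univ_three, Prod.fst_neg, Prod.snd_neg, Int.cast_neg, Int.cast_one, triangularVec₁, triangularVec₂, barlowOffset,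
      layerNormal, PiLp.add_apply, PiLp.smul_apply, smul_eq_mul, Real.norm_eq_abs, sq_abs]
    simp
    ring
  simp only [Equiv.neg_apply, key]

end LayerSums

end Summit.AtomisticToContinuum.Crystallization.Theorems.ChargedEnergyGapChartDial
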